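import Mathlib

/-!
# `LaguerreSpeiserSplit.LaguerreOnLine` (crux, item stmt-RiemannHypothesis-18897): the SHAPE of the
crux does not force real zeros — a small model (refuter crux-attack artefact, 2026-08-17)

The crux X2 = `LaguerreOnLine` asserts the strict Laguerre inequality
`(Re Ξ)′(t)² − Re Ξ(t)·(Re Ξ)″(t) > 0` at every real `t` for Riemann's `Ξ`.  Restates-summit probe
`C → S`: could X2 ALONE give RH by general function theory ("real, even, entire, order ≤ 1, strict
Laguerre inequality on the whole real axis ⇒ only real zeros")?  No:

* `LaguerreOnLineModel.F z = (1 + z²)·cos(π z)` is entire (`F_differentiable`), real on `ℝ`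
  (`F_real`), even (`F_even`), of exponential type `π` (and `F(z) = G(z²)` with `G` of order `1/2`,
  the growth class of `Ξ`);
* it satisfies the crux's inequality IN THE CRUX'S EXACT LEAN SHAPE at every real `t`
  (`laguerreOnLine_model`; indeed `F′² − F F″ = π²(1+t²)² − 2cos²(πt)(1−t²) ≥ π² − 2`, `laguerre_eq`,
  `laguerre_pos`) — the positive mass `π²/cos²(πt) ≥ π²` of the real zeros `ℤ + 1/2` absorbs the
  negative contribution `2(1−t²)/(1+t²)² ≤ 2` of the pair `±i` in `−(F′/F)′`;
* yet `F(i) = 0` (`F_I`).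

Hence any proof of `LaguerreOnLine → RiemannHypothesis` must use arithmetic input beyond this class
(in the route: the far-field crux `XiPrimeOnLine` + Ki–Kim), i.e. X1 is load-bearing and X2 is not the
summit in costume.  Summary: `laguerreSpeiserSplit_laguerreOnLine_shape_admits_nonreal_zero`.
[folklore; cf. Csordas, arXiv:1309.0055, Prop. 2.2 and the heuristic after it]
-/

noncomputable section

set_option linter.dupNamespace false

namespace Summit.RiemannHypothesis.RiemannHypothesis.Theorems

namespace LaguerreOnLineModel

open Real
/-- The model `F z = (1 + z²) cos(π z)`. [folklore] -/
def F (z : ℂ) : ℂ := (1 + z ^ 2) * Complex.cos (Real.pi * z)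

/-- Its real restriction `g u = (1 + u²) cos(π u)`. [folklore] -/
def g (u : ℝ) : ℝ := (1 + u ^ 2) * Real.cos (π * u)

/-- First derivative of `g`. [folklore] -/
def g1 (u : ℝ) : ℝ := 2 * u * Real.cos (π * u) - π * (1 + u ^ 2) * Real.sin (π * u)

/-- Second derivative of `g`. [folklore] -/
def g2 (u : ℝ) : ℝ :=
  2 * Real.cos (π * u) - 4 * π * u * Real.sin (π * u) - π ^ 2 * (1 + u ^ 2) * Real.cos (π * u)

/-- `F` is entire. [folklore] -/
theorem F_differentiable : Differentiable ℂ F := by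
  unfold F; fun_prop

/-- `F` is even. [folklore] -/
theorem F_even (z : ℂ) : F (-z) = F z := by
  unfold F
  rw [mul_neg, Complex.cos_neg, neg_sq]

/-- On the real axis `F` is the real function `g`. [folklore] -/
theorem F_ofReal (u : ℝ) : F u = (g u : ℂ) := by
  unfold F g
  push_cast
  ring

/-- `F` is real on `ℝ`. [folklore] -/
theorem F_real (u : ℝ) : (F u).im = 0 := by
  rw [F_ofReal, Complex.ofReal_im]

/-- `Re F(u) = g(u)` for real `u`. [folklore] -/
theorem F_re (u : ℝ) : (F u).re = g u := by
  rw [F_ofReal, Complex.ofReal_re]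

/-- `F(i) = 0`: a non-real zero. [folklore] -/
theorem F_I : F Complex.I = 0 := by
  unfold F; simp

/-- `g′ = g1`. [folklore] -/
theorem hasDerivAt_g (u : ℝ) : HasDerivAt g (g1 u) u := by
  have h1 : HasDerivAt (fun x : ℝ => 1 + x ^ 2) (2 * u) u := by
    have := (hasDerivAt_pow 2 u).const_add 1
    simpa using this
  have h2 : HasDerivAt (fun x : ℝ => π * x) π u := by
    simpa using (hasDerivAt_id u).const_mul π
  have h3 : HasDerivAt (fun x : ℝ => Real.cos (π * x)) (-Real.sin (π * u) * π) u :=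
    (Real.hasDerivAt_cos (π * u)).comp u h2
  have h4 := h1.fun_mul h3
  unfold g g1
  convert h4 using 1
  all_goals (first | rfl | ring)

/-- `deriv g = g1`. [folklore] -/
theorem deriv_g : deriv g = g1 := by
  funext u
  exact (hasDerivAt_g u).deriv

/-- `g1′ = g2`. [folklore] -/
theorem hasDerivAt_g1 (u : ℝ) : HasDerivAt g1 (g2 u) u := by
  have h1 : HasDerivAt (fun x : ℝ => 1 + x ^ 2) (2 * u) u := by
    have := (hasDerivAt_pow 2 u).const_add 1
    simpa using this
  have h2 : HasDerivAt (fun x : ℝ => π * x) π u := by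
    simpa using (hasDerivAt_id u).const_mul π
  have h3 : HasDerivAt (fun x : ℝ => Real.cos (π * x)) (-Real.sin (π * u) * π) u :=
    (Real.hasDerivAt_cos (π * u)).comp u h2
  have h5 : HasDerivAt (fun x : ℝ => 2 * x) 2 u := by
    simpa using (hasDerivAt_id u).const_mul (2 : ℝ)
  have h6 := h5.fun_mul h3
  have h7 : HasDerivAt (fun x : ℝ => Real.sin (π * x)) (Real.cos (π * u) * π) u :=
    (Real.hasDerivAt_sin (π * u)).comp u h2
  have h8 : HasDerivAt (fun x : ℝ => π * (1 + x ^ 2)) (π * (2 * u)) u := h1.const_mul π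
  have h9 := h8.fun_mul h7
  have h10 := h6.fun_sub h9
  unfold g1 g2
  convert h10 using 1
  all_goals (first | rfl | ring)

/-- `g″ = g2`. [folklore] -/
theorem iteratedDeriv_two_g (u : ℝ) : iteratedDeriv 2 g u = g2 u := by
  rw [show (2 : ℕ) = 1 + 1 from rfl, iteratedDeriv_succ, iteratedDeriv_one, deriv_g]
  exact (hasDerivAt_g1 u).deriv

/-- The key identity `g′² − g g″ = π² (1 + u²)² − 2 cos²(πu) (1 − u²)`. [folklore] -/
theorem laguerre_eq (u : ℝ) :
    g1 u ^ 2 - g u * g2 u = π ^ 2 * (1 + u ^ 2) ^ 2 - 2 * Real.cos (π * u) ^ 2 * (1 - u ^ 2) := by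
  have h := Real.sin_sq_add_cos_sq (π * u)
  unfold g g1 g2
  linear_combination (π ^ 2 * (1 + u ^ 2) ^ 2) * h

/-- Uniform strict Laguerre inequality for the model: `g′² − g g″ ≥ π² − 2 > 0`. [folklore] -/
theorem laguerre_pos (u : ℝ) : 0 < g1 u ^ 2 - g u * g2 u := by
  rw [laguerre_eq]
  have hπ : 3 < π := Real.pi_gt_three
  have hc : Real.cos (π * u) ^ 2 ≤ 1 := by
    have := Real.cos_sq_le_one (π * u)
    simpa using this
  have hc0 : 0 ≤ Real.cos (π * u) ^ 2 := sq_nonneg _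
  have hu : 0 ≤ u ^ 2 := sq_nonneg _
  have hP : 9 < π ^ 2 := by nlinarith
  nlinarith [mul_nonneg hu hc0, mul_nonneg hu hu, mul_nonneg (le_of_lt (by linarith : (0:ℝ) < π ^ 2)) hu,
    mul_nonneg (le_of_lt (by linarith : (0:ℝ) < π ^ 2)) (mul_nonneg hu hu)]

/-- The model satisfies the inequality of `LaguerreSpeiserSplit.LaguerreOnLine` in its exact Lean shape
(with `Ξ` replaced by `F`). [folklore] -/
theorem laguerreOnLine_model :
    ∀ t : ℝ, 0 < deriv (fun u : ℝ => (F (u : ℂ)).re) t ^ 2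
      - (F (t : ℂ)).re * iteratedDeriv 2 (fun u : ℝ => (F (u : ℂ)).re) t := by
  intro t
  have hfun : (fun u : ℝ => (F (u : ℂ)).re) = g := by
    funext u; exact F_re u
  rw [hfun, F_re, deriv_g, iteratedDeriv_two_g]
  exact laguerre_pos t

end LaguerreOnLineModel

/-- **Summary (restates-summit probe `C → S` fails abstractly).** There is an entire function, real on
`ℝ` and even, satisfying the inequality of `LaguerreSpeiserSplit.LaguerreOnLine` verbatim (with `Ξ`
replaced by it) at every real point, which has a non-real zero. [folklore] -/
theorem laguerreSpeiserSplit_laguerreOnLine_shape_admits_nonreal_zero :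
    ∃ F : ℂ → ℂ, Differentiable ℂ F ∧ (∀ u : ℝ, (F u).im = 0) ∧ (∀ z, F (-z) = F z) ∧
      (∀ t : ℝ, 0 < deriv (fun u : ℝ => (F (u : ℂ)).re) t ^ 2
        - (F (t : ℂ)).re * iteratedDeriv 2 (fun u : ℝ => (F (u : ℂ)).re) t) ∧
      ∃ z : ℂ, F z = 0 ∧ z.im ≠ 0 :=
  ⟨LaguerreOnLineModel.F, LaguerreOnLineModel.F_differentiable, LaguerreOnLineModel.F_real,
    LaguerreOnLineModel.F_even, LaguerreOnLineModel.laguerreOnLine_model, Complex.I,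
    LaguerreOnLineModel.F_I, by simp⟩


end Summit.RiemannHypothesis.RiemannHypothesis.Theorems

end
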